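import Literature.NumberTheory.EllipticCurves.RohrlichNonvanishingCompositeProofs
import Literature.NumberTheory.EllipticCurves.CuspFormRankinSelbergCoefficients
import Literature.NumberTheory.Automorphic.RankinSelbergContinuationSL2
import Literature.NumberTheory.Automorphic.RankinSelbergGrowthSL2
import Literature.Analysis.Complex.PerronPowerSaving
import HarnessLib

/-!
# Rohrlich's non-vanishing theorem for twists: the discharge
(`Rohrlich1984_nonvanishing_twists_holds`), via an unconditional Rankin–Selberg power saving

Topic `NumberTheory/EllipticCurves`; namespace `Literature.NumberTheory.EllipticCurves`. Proof file
(theorems only; no definition, no named fact). The named fact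
`Rohrlich1984_nonvanishing_twists` (Rohrlich, Invent. Math. 75 (1984), Theorem 1: for a weight-2
newform `f` on `Γ₀(N)` and a finite set `P` of primes not dividing `N`, `L(1, f ⊗ χ) = 0` for only
finitely many primitive `χ` with conductor supported on `P`) was reduced in
`RohrlichNonvanishingCompositeProofs` (`Rohrlich1984_nonvanishing_twists_of_coeffBound'`, the
Galois-averaged first-moment argument of Rohrlich §§1–4 over the coefficient field) to a
**pointwise power bound `|a_n(f)| ≤ C n^θ` with some `θ < 1`** for the Fourier coefficients of
weight-2 newforms. Rohrlich uses Deligne's bound (`θ = 1/2 + o(1)`); any `θ < 1` suffices for his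
argument, and we supply `θ = 1 - 1/512` UNCONDITIONALLY by the Rankin–Selberg method
(Rankin 1939, Selberg 1940) against the level-one real-analytic Eisenstein series — the route that
avoids the Weil conjectures:

1. `coeff_powerSaving_of_horocycle` — the abstract engine: an `SL₂(ℤ)`-invariant continuous
   bounded `G ≥ 0` on `ℍ` with horocycle averages `∫₀¹ G(x+iy) dx = y² Σ Cₙ e^{-a n y}` (`Cₙ ≥ 0`)
   has `Cₙ ≤ K n^{2 - 1/256}`: unfolding against `E(z,s)` (`RankinSelbergHorocycleMellin`),
   continuation and functional equation of `∫_𝒟 G E*` (`RankinSelbergContinuationSL2`),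
   Phragmén–Lindelöf for the `Γ`-compensated function and the continued Dirichlet series with its
   simple pole at `w = 2` (`RankinSelbergGrowthSL2`), and Perron's formula of order six with the
   Riesz-mean descent (`Literature.Analysis.Complex.PerronPowerSaving`);
2. `rsCoeff_le_pow` — applied to the trace `G_f = Σ_{SL₂(ℤ)/Γ₀(N)} |f|_2 A⁻¹|² y²`
   (`CuspFormRankinSelbergTrace`, `CuspFormRankinSelbergCoefficients`): the coefficient sequence
   `rsCoeff N 2 f` of the trace is `≪ n^{2 - 1/256}`;
3. `norm_cuspCoeff_le_pow` — `|a_m(f)|² ≤ rsCoeff(N m)` gives **`|a_m(f)| ≤ C m^{1 - 1/512}`** for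
   every `f ∈ S₂(Γ₀(N))`;
4. `Rohrlich1984_nonvanishing_twists_holds`.

## References

* D. E. Rohrlich, *On L-functions of elliptic curves and cyclotomic towers*, Invent. Math. 75
  (1984), 409–423, Theorem 1. [cite: RohrlichInventiones1984, Theorem 1]
* R. A. Rankin, Proc. Cambridge Philos. Soc. 35 (1939), 357–372. [cite: Rankin1939, §4]
* A. Selberg, Arch. Math. Naturvid. 43 (1940), 47–50. [cite: Selberg1940]
-/

noncomputable section

open Complex MeasureTheory Set Filter Real
open UpperHalfPlane hiding I
open scoped Topology MatrixGroups ModularForm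

namespace Literature.NumberTheory.EllipticCurves

open Literature.NumberTheory.Automorphic Literature.NumberTheory.EllipticCurves.ModularForms
  CongruenceSubgroup

/-! ### The abstract engine (`κ = 2`) -/

/-- **Rankin–Selberg power saving, abstract form (`κ = 2`).** Let `G : ℍ → ℝ` be continuous,
`SL₂(ℤ)`-invariant, `0 ≤ G ≤ B`, with horocycle averages `∫₀¹ G(x+iy) dx = y² Σₙ Cₙ e^{-a n y}`
(`Cₙ ≥ 0`, `C₀ = 0`, `a > 0`) and `Σₙ Cₙ e^{-any} ≤ B y^{-2}`. Then `Cₙ ≤ K n^{2 - 1/256}` for all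
`n ≥ 1`. (Rankin 1939, Theorem 3 with the exponent `2 - 2/5` for `κ = 12`; here a cruder but
explicit exponent from a six-fold Riesz descent.) [cite: Rankin1939, §4] -/
theorem coeff_powerSaving_of_horocycle {G : ℍ → ℝ} {C : ℕ → ℝ} {a B : ℝ} (hGc : Continuous G)
    (hGinv : ∀ (A : SL(2, ℤ)) (τ : ℍ), G (A • τ) = G τ) (hG0 : ∀ τ, 0 ≤ G τ)
    (hGB : ∀ τ, G τ ≤ B) (hC : ∀ n, 0 ≤ C n) (hC0 : C 0 = 0) (ha : 0 < a)
    (hs : ∀ y : ℝ, 0 < y → Summable fun n : ℕ ↦ C n * Real.exp (-a * n * y))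
    (hle : ∀ y : ℝ, 0 < y → ∑' n : ℕ, C n * Real.exp (-a * n * y) ≤ B * y ^ (-(2 : ℝ)))
    (hm : ∀ y : ℝ, 0 < y → ∫ x in (0 : ℝ)..1, G (pt x y) = y ^ (2 : ℝ) * ∑' n : ℕ, C n * Real.exp (-a * n * y)) :
    ∃ K' : ℝ, ∀ n : ℕ, 1 ≤ n → C n ≤ K' * (n : ℝ) ^ (2 - 1 / 256 : ℝ) := by
  have hκ : (0 : ℝ) ≤ 2 := by norm_num
  -- the entire function `J(s) = ∫_𝒟 G E*(·, s)` and `V = ∫_𝒟 G`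
  set J : ℂ → ℂ := fun s ↦ ∫ w in ModularGroup.fd, (G w : ℂ) * completedEisenstein₀ w s with hJdef
  set V : ℂ := ∫ w in ModularGroup.fd, (G w : ℂ) with hVdef
  have hJ : Differentiable ℂ J := differentiable_J₀ hGc hGinv hG0 hGB hC hC0 ha hκ hs hm
  have hJfe : ∀ s, J (1 - s) = J s := fun s ↦ J₀_one_sub G s
  have hJeq : ∀ s : ℂ, 1 < s.re → J s = (π : ℂ) ^ (-s) * Complex.Gamma s * riemannZeta (2 * s) *
      (Complex.Gamma (s + 1) * (a : ℂ) ^ (-(s + 1)) * LSeries (fun n ↦ (C n : ℂ)) (s + 1)) +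
        (1 / (2 * s) + 1 / (2 * (1 - s))) * V := by
    intro s hs1
    have h := J₀_eq_of_one_lt_re hGc hGinv hG0 hGB hC hC0 ha hκ hs hle hm hs1
    have e : s + ((2 : ℝ) : ℂ) - 1 = s + 1 := by push_cast; ring
    rw [e] at h
    exact h
  have hJbd : ∃ M : ℝ, ∀ s : ℂ, -1 / 2 ≤ s.re → s.re ≤ 3 / 2 → ‖J s‖ ≤ M :=
    norm_J₀_le hGc hGinv hG0 hGB hC hC0 ha hκ hs hm (σa := -1 / 2) (σb := 3 / 2) (by norm_num) (by norm_num)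
  have hCs : Summable fun n : ℕ ↦ C n / (n : ℝ) ^ (5 / 2 : ℝ) :=
    summable_div_rpow_of_horocycle hC ha hs hle (by norm_num)
  -- Phragmén–Lindelöf for `g`
  obtain ⟨K, hK0, hg⟩ := exists_norm_g_le_pow (V := V) hC ha hCs hJ hJfe hJeq hJbd
  -- the continued Dirichlet series and its pole part
  set Dt : ℂ → ℂ := fun w ↦ ((w - 1) * ((w - 1) - 1) * J (w - 1) + V / 2) * (Complex.Gamma (w - 1))⁻¹ *
      (Complex.Gamma ((w - 1) + 1))⁻¹ * (a : ℂ) ^ w * (π : ℂ) ^ (w - 1) /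
        ((w - 1) * (w - 2) * riemannZeta (2 * w - 2)) with hDt
  set φ : ℂ → ℂ := fun w ↦ ((w - 1) * ((w - 1) - 1) * J (w - 1) + V / 2) * (Complex.Gamma (w - 1))⁻¹ *
      (Complex.Gamma ((w - 1) + 1))⁻¹ * (a : ℂ) ^ w * (π : ℂ) ^ (w - 1) /
        ((w - 1) * riemannZeta (2 * w - 2)) with hφ
  have hDiff : DifferentiableOn ℂ Dt {w : ℂ | 3 / 2 < w.re ∧ w ≠ 2} :=
    differentiableOn_continuation (V := V) ha hJ
  have hEq : ∀ w : ℂ, 2 < w.re → Dt w = LSeries (fun n ↦ (C n : ℂ)) w :=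
    fun w hw ↦ continuation_eq_LSeries (V := V) ha hJeq hw
  have hφd : ∀ w : ℂ, 3 / 2 < w.re → DifferentiableAt ℂ φ w :=
    fun w hw ↦ differentiableAt_phi (V := V) ha hJ hw
  have hφeq : ∀ w : ℂ, Dt w = φ w / (w - 2) := fun w ↦ continuation_eq_div (a := a) (V := V) (J := J) w
  -- the residue is `3a²V/π ≥ 0`
  have hV : V = ((∫ w in ModularGroup.fd, G w : ℝ) : ℂ) := integral_ofReal
  have hV0 : 0 ≤ ∫ w in ModularGroup.fd, G w := integral_nonneg fun w ↦ hG0 w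
  have hφ2 : 0 ≤ (φ 2).re := by
    have h : φ 2 = 3 * (a : ℂ) ^ 2 * V / π := continuation_residue a V J
    rw [h, hV, show (3 : ℂ) * (a : ℂ) ^ 2 * ((∫ w in ModularGroup.fd, G w : ℝ) : ℂ) / π =
      ((3 * a ^ 2 * (∫ w in ModularGroup.fd, G w) / Real.pi : ℝ) : ℂ) by push_cast; ring, Complex.ofReal_re]
    positivity
  -- polynomial growth in the strip (`ε = 1/4`)
  have hZ0 : 0 ≤ ∑' n : ℕ, (n : ℝ) ^ (-(1 + 2 * (1 / 4 : ℝ))) :=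
    tsum_nonneg fun n ↦ Real.rpow_nonneg (Nat.cast_nonneg n) _
  have hbd : ∀ w : ℂ, 3 / 2 + (1 / 4 : ℝ) ≤ w.re → w.re ≤ 5 / 2 → 1 ≤ |w.im| →
      ‖Dt w‖ ≤ (4 * K * (7 / 2) ^ 7 * (a ^ (3 / 2 : ℝ) + a ^ (5 / 2 : ℝ)) * π ^ (3 / 2 : ℝ) *
        ∑' n : ℕ, (n : ℝ) ^ (-(1 + 2 * (1 / 4 : ℝ)))) * (1 + |w.im|) ^ 5 :=
    fun w h1 h2 h3 ↦ norm_continuation_le (V := V) ha hK0 hg (ε := 1 / 4) (by norm_num) h1 h2 h3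
  obtain ⟨K', hK'⟩ := Literature.Analysis.Complex.coeff_powerSaving_of_continuation hC hCs hDiff hEq hφd
    hφeq hφ2 (ε := 1 / 4) (by norm_num) (by norm_num) (by positivity) hbd
  refine ⟨K', fun n hn ↦ ?_⟩
  have h := hK' n hn
  rwa [show (2 : ℝ) - (1 / 2 - 1 / 4) / 64 = 2 - 1 / 256 by norm_num] at h

/-! ### The coefficient bound for `S₂(Γ₀(N))` -/

variable {N : ℕ} [NeZero N]

/-- `pt x y = ofComplex (x + iy)`. [folklore] -/
theorem pt_eq_ofComplex (x y : ℝ) : pt x y = ofComplex ((x : ℂ) + y * I) := by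
  rw [pt, Complex.mk_eq_add_mul_I]

/-- **The coefficient sequence of the Rankin–Selberg trace of a weight-2 cusp form is
`≪ n^{2 - 1/256}`** (`coeff_powerSaving_of_horocycle` for `G_f = rsTrace N 2 f`,
`Cₙ = rsCoeff N 2 f n`, `a = 4π/N`). [cite: Rankin1939, §4] -/
theorem rsCoeff_le_pow (f : CuspForm (Gamma0 N) 2) :
    ∃ K' : ℝ, ∀ n : ℕ, 1 ≤ n → rsCoeff N 2 f n ≤ K' * (n : ℝ) ^ (2 - 1 / 256 : ℝ) := by
  have hN0 : (0 : ℝ) < N := Nat.cast_pos.mpr (NeZero.pos N)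
  obtain ⟨B, hB0, hB⟩ := exists_rsTrace_le f
  set a : ℝ := 4 * Real.pi / N with ha
  have ha0 : 0 < a := by positivity
  have hexp : ∀ (n : ℕ) (y : ℝ), Real.exp (-a * n * y) = Real.exp (-(4 * Real.pi * n / N) * y) := by
    intro n y; congr 1; rw [ha]; ring
  have hs : ∀ y : ℝ, 0 < y → Summable fun n : ℕ ↦ rsCoeff N 2 f n * Real.exp (-a * n * y) := by
    intro y hy; simp_rw [hexp]; exact summable_rsCoeff_mul_exp f hy
  have hle : ∀ y : ℝ, 0 < y → ∑' n : ℕ, rsCoeff N 2 f n * Real.exp (-a * n * y) ≤ B * y ^ (-(2 : ℝ)) := by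
    intro y hy
    simp_rw [hexp]
    have h := tsum_rsCoeff_mul_exp_le f hB hy
    rwa [Real.rpow_neg hy.le, Real.rpow_two, ← zpow_ofNat, ← div_eq_mul_inv]
  have hm : ∀ y : ℝ, 0 < y → ∫ x in (0 : ℝ)..1, rsTrace N 2 f (pt x y) =
      y ^ (2 : ℝ) * ∑' n : ℕ, rsCoeff N 2 f n * Real.exp (-a * n * y) := by
    intro y hy
    simp_rw [hexp, pt_eq_ofComplex]
    rw [intervalIntegral_rsTrace_horizontal f hy, Real.rpow_two, ← zpow_ofNat]
  exact coeff_powerSaving_of_horocycle (continuous_rsTrace (ModularFormClass.continuous f))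
    (fun A τ ↦ rsTrace_smul f A τ) (fun τ ↦ rsTrace_nonneg _ τ) hB (fun n ↦ rsCoeff_nonneg _ n)
    (rsCoeff_zero f) ha0 hs hle hm

/-- **An unconditional power bound for the Fourier coefficients of weight-2 cusp forms**:
for `f ∈ S₂(Γ₀(N))` there is `C ≥ 0` with `|a_n(f)| ≤ C n^{1 - 1/512}` for all `n`
(`|a_m(f)|² ≤ rsCoeff(N m) ≪ (N m)^{2 - 1/256}`; Rankin 1939 / Selberg 1940 give the sharper
`n^{k/2 - 1/5}`). [cite: Rankin1939, Theorem 3] -/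
theorem norm_cuspCoeff_le_pow (f : CuspForm (Gamma0 N) 2) :
    ∃ C : ℝ, 0 ≤ C ∧ ∀ n : ℕ, ‖cuspCoeff f n‖ ≤ C * (n : ℝ) ^ (1 - 1 / 512 : ℝ) := by
  have hN0 : (0 : ℝ) < N := Nat.cast_pos.mpr (NeZero.pos N)
  have hN1 : (1 : ℝ) ≤ N := by exact_mod_cast NeZero.one_le
  obtain ⟨K', hK'⟩ := rsCoeff_le_pow f
  set K : ℝ := max K' 0 with hK
  have hK0 : 0 ≤ K := le_max_right _ _
  refine ⟨Real.sqrt (K * (N : ℝ) ^ (2 - 1 / 256 : ℝ)), Real.sqrt_nonneg _, fun n ↦ ?_⟩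
  rcases Nat.eq_zero_or_pos n with rfl | hn
  · -- `a_0 = 0`
    have h := norm_sq_cuspCoeff_le_rsCoeff (N := N) f 0
    rw [mul_zero, rsCoeff_zero] at h
    have h0 : ‖cuspCoeff f 0‖ = 0 := by nlinarith [norm_nonneg (cuspCoeff f 0)]
    rw [h0, Nat.cast_zero, Real.zero_rpow (by norm_num), mul_zero]
  · have hNn : 1 ≤ N * n := Nat.one_le_iff_ne_zero.mpr (Nat.mul_ne_zero (NeZero.ne N) (by omega))
    have h1 := norm_sq_cuspCoeff_le_rsCoeff (N := N) f n
    have h2 := (hK' (N * n) hNn).trans (mul_le_mul_of_nonneg_right (le_max_left K' 0) (by positivity))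
    have hn0 : (0 : ℝ) ≤ n := Nat.cast_nonneg n
    have hsq : ‖cuspCoeff f n‖ ^ 2 ≤ (K * (N : ℝ) ^ (2 - 1 / 256 : ℝ)) * ((n : ℝ) ^ (1 - 1 / 512 : ℝ)) ^ 2 := by
      calc ‖cuspCoeff f n‖ ^ 2 ≤ rsCoeff N 2 f (N * n) := h1
        _ ≤ K * ((N * n : ℕ) : ℝ) ^ (2 - 1 / 256 : ℝ) := h2
        _ = (K * (N : ℝ) ^ (2 - 1 / 256 : ℝ)) * ((n : ℝ) ^ (1 - 1 / 512 : ℝ)) ^ 2 := by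
            rw [Nat.cast_mul, Real.mul_rpow hN0.le hn0, ← Real.rpow_natCast, ← Real.rpow_mul hn0]
            norm_num; ring
    have hrhs : 0 ≤ Real.sqrt (K * (N : ℝ) ^ (2 - 1 / 256 : ℝ)) * (n : ℝ) ^ (1 - 1 / 512 : ℝ) := by positivity
    calc ‖cuspCoeff f n‖ = Real.sqrt (‖cuspCoeff f n‖ ^ 2) := (Real.sqrt_sq (norm_nonneg _)).symm
      _ ≤ Real.sqrt ((K * (N : ℝ) ^ (2 - 1 / 256 : ℝ)) * ((n : ℝ) ^ (1 - 1 / 512 : ℝ)) ^ 2) := Real.sqrt_le_sqrt hsq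
      _ = Real.sqrt (K * (N : ℝ) ^ (2 - 1 / 256 : ℝ)) * (n : ℝ) ^ (1 - 1 / 512 : ℝ) := by
          rw [Real.sqrt_mul (by positivity), Real.sqrt_sq (by positivity)]

/-! ### The discharge -/

/-- **Rohrlich's theorem (Invent. Math. 75 (1984), Theorem 1), discharged**: for every weight-2
newform `f` on `Γ₀(N)` and every finite set `P` of primes not dividing `N`, only finitely many
primitive Dirichlet characters `χ` with conductor supported on `P` have `L(1, f ⊗ χ) = 0`.
Rohrlich's Galois-averaged first-moment argument (`RohrlichNonvanishing*Proofs`) needs only a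
power bound `|a_n(f)| ≪ n^θ` with `θ < 1`, supplied here unconditionally by Rankin–Selberg
(`norm_cuspCoeff_le_pow`, `θ = 1 - 1/512`) instead of Deligne's theorem.
[cite: RohrlichInventiones1984, Theorem 1] -/
theorem Rohrlich1984_nonvanishing_twists_holds : Rohrlich1984_nonvanishing_twists :=
  Rohrlich1984_nonvanishing_twists_of_coeffBound' fun {_} _ {f} _ ↦ by
    obtain ⟨C, hC, h⟩ := norm_cuspCoeff_le_pow f
    exact ⟨C, 1 - 1 / 512, hC, by norm_num, by norm_num, h⟩

end Literature.NumberTheory.EllipticCurves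

end
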